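import Literature.InformationTheory.Entanglement.WernerStateSeparability
import HarnessLib

/-!
# The nearest separable state and its entanglement witness (Bertlmann–Durstberger–Hiesmayr–Krammer 2005, § 3.3
# Lemma; Bertlmann–Krammer 2009 Lemma 1; Bertlmann–Friis Lemma 17.1)

Hodge foundations lane (`lit-hodgefound`, prover p24 gen 78; quantum-information series).  THEOREMS ONLY: no
definition, no named fact, net debt 0.  Vocabulary of the tree: `IsSeparable`, `IsWitness` (`WernerStateSeparability
.lean`: Bertlmann–Friis Definition 15.5, Gühne–Tóth Definition 8: `Tr(Wρ_s) ≥ 0` on separable states and `Tr(Wρ_e) < 0`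
for some entangled state).  The Hilbert–Schmidt pairing of Hermitian matrices `⟨A, B⟩ = Tr(A†B)` is `Re Tr(AB)`,
`‖A‖² = Re Tr(A²)`; «`ρ̃` is the nearest separable state to `ρ_ent`» is spelled
`∀ ρ separable, ‖ρ̃ − ρ_ent‖² ≤ ‖ρ − ρ_ent‖²`.  The witness operator is used UN-normalised,
`C' = ρ̃ − ρ_ent − ⟨ρ̃, ρ̃ − ρ_ent⟩𝟙 = ‖ρ̃ − ρ_ent‖ · C̃` (a positive multiple: the same sign conditions).

## Sources, VERBATIM

R. A. Bertlmann, K. Durstberger, B. C. Hiesmayr, P. Krammer, *Optimal entanglement witnesses for qubits and qutrits*,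
Phys. Rev. A 72, 052331 (2005) [BertlmannDurstbergerHiesmayrKrammer2005] (held `paper:arxiv-quant-ph_0508043` p0007–
p0008): § 3.1 «`C := (ρ₁ − ρ₂ − ⟨ρ₁, ρ₁ − ρ₂⟩𝟙)/‖ρ₁ − ρ₂‖` … we define a hyperplane `P` that includes `ρ₁` and is
orthogonal to `ρ₁ − ρ₂` … `⟨ρ, C⟩ = ⟨ρ, (ρ₁−ρ₂)/‖ρ₁−ρ₂‖⟩ − (⟨ρ₁, ρ₁−ρ₂⟩/‖ρ₁−ρ₂‖)⟨ρ, 𝟙⟩ = (1/‖ρ₁−ρ₂‖)⟨ρ − ρ₁, ρ₁ − ρ₂⟩`.»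
§ 3.2 «For an entangled state `ρ_ent` the minimum of the Hilbert–Schmidt distance … is attained for some state `ρ₀` …
The state `ρ₀` lies on the boundary of the set of all separable states `S` and the hyperplane defined by `⟨ρ_p, C⟩ = 0`
is orthogonal to `ρ₀ − ρ_ent`. Because `ρ₀` is the nearest separable state to `ρ_ent` the plane has to be tangent to the
set `S` … it therefore follows that `C` is an optimal entanglement witness.»
§ 3.3 «**Lemma.** A state `ρ̃` is equal to the nearest separable state `ρ₀` if and only if `C̃` is an entanglement
witness. Proof. We already know from Sect. 3.2 that if `ρ̃` is the nearest separable state then the operator `C̃` is an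
entanglement witness. So we need to prove the opposite … We prove it indirectly. If `ρ̃` is not the nearest separable
state then `‖ρ_ent − ρ̃‖` does not give the minimal distance to `S`; the plane defined by `⟨ρ_p, C̃⟩ = 0` is not
tangent to `S` and thus the existence of ‘left-hand’ separable states `ρ_sep` satisfying `⟨ρ_sep, C̃⟩ < 0` follows.»
Restated: R. A. Bertlmann, P. Krammer, Ann. Phys. 324 (2009) 1388 [BertlmannKrammer2009] § 3 Lemma 1; R. Bertlmann,
N. Friis, *Modern Quantum Theory* (OUP 2023) [BertlmannFriis2023] § 17.1.3 Lemma 17.1 (held p0566).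

## Proof route

The printed tangent-plane argument made quantitative: with `X = ρ̃ − ρ_ent`, for every trace-one `ρ`
`Tr(ρ C') = ⟨ρ − ρ̃, X⟩` (§ 3.1) and `‖ρ − ρ_ent‖² = ‖ρ − ρ̃‖² + 2⟨ρ − ρ̃, X⟩ + ‖X‖²`.  Hence non-negativity of `C'`
on `S` gives minimality (⇐); conversely, if `ρ̃` is nearest and `ρ ∈ S`, the segment `ρ_t = tρ + (1−t)ρ̃ ⊆ S`
(convexity, the tree's `IsSeparable.mix`) has `‖ρ_t − ρ_ent‖² − ‖X‖² = 2t⟨ρ − ρ̃, X⟩ + t²‖ρ − ρ̃‖² ≥ 0` for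
`t ∈ (0,1]`, forcing `⟨ρ − ρ̃, X⟩ ≥ 0` — the «left-hand separable states» cannot exist (⇒).  Finally
`Tr(ρ_ent C') = −‖X‖² < 0` when `ρ̃ ≠ ρ_ent` («by construction»), so `C'` detects `ρ_ent`.

## What is formalized (all PROVED)

`re_trace_mul_self_nonneg` / `re_trace_mul_self_eq_zero_iff` (`‖A‖² ≥ 0`, `= 0 ⟺ A = 0`, Hermitian `A`),
`re_trace_mul_witnessOp` (§ 3.1: `Tr(ρC') = ⟨ρ − ρ̃, ρ̃ − ρ_ent⟩`), `hsDist_sq_expand`, `re_trace_ent_mul_witnessOp`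
(`Tr(ρ_ent C') = −‖ρ̃ − ρ_ent‖²`), **`isNearest_of_witnessOp_nonneg`** (⇐), **`witnessOp_nonneg_of_isNearest`** (⇒),
**`isNearest_iff_isWitness`** (the Lemma with the tree's `IsWitness`, for an entangled state `ρ_ent` and a separable
guess `ρ̃`).

NOT formalized: existence of the minimiser (compactness of `S`), the Bertlmann–Narnhofer–Thirring theorem
`D(ρ_ent) = B(ρ_ent)` (§ 3.2).  Tree search (FAIL-DUP, 2026-09-01): `rg -n "nearest separable|Lemma 17.1|Hilbert-Schmidt
measure" Literature/InformationTheory` → prose only (`BertlmannKrammerQubitWitnessLemma.lean` header); `IsWitness` users: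
`WernerStateSeparability.lean` (PPT witnesses) only.
-/

noncomputable section

open Matrix Finset
open scoped ComplexOrder

namespace Literature.InformationTheory.Entanglement.NearestSeparable

open Literature.InformationTheory.Entanglement.PPT (IsSeparable IsWitness)

variable {m n : Type*} [Fintype m] [Fintype n] [DecidableEq m] [DecidableEq n]

/-! ## § 1 The Hilbert–Schmidt form on Hermitian matrices -/

omit [DecidableEq m] [DecidableEq n] in
/-- `‖A‖² = Re Tr(A²) ≥ 0` for Hermitian `A`. [cite: BertlmannDurstbergerHiesmayrKrammer2005, §2 («Hilbert–Schmidt norm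
`‖A‖ = √⟨A, A⟩`»)] -/
theorem re_trace_mul_self_nonneg {A : Matrix (m × n) (m × n) ℂ} (hA : A.IsHermitian) : 0 ≤ (A * A).trace.re := by
  have h := (posSemidef_self_mul_conjTranspose A).trace_nonneg
  rw [hA.eq] at h
  exact (Complex.nonneg_iff.mp h).1

omit [DecidableEq m] [DecidableEq n] in
/-- `‖A‖² = 0 ⟺ A = 0` for Hermitian `A`. [cite: BertlmannDurstbergerHiesmayrKrammer2005, §2 («Hilbert–Schmidt
distance … `d_HS(ρ₁,ρ₂) = ‖ρ₁ − ρ₂‖`»)] -/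
theorem re_trace_mul_self_eq_zero_iff {A : Matrix (m × n) (m × n) ℂ} (hA : A.IsHermitian) :
    (A * A).trace.re = 0 ↔ A = 0 := by
  constructor
  · intro h
    have hps := posSemidef_self_mul_conjTranspose A
    have him : (A * Aᴴ).trace.im = 0 := by
      have := (Complex.nonneg_iff.mp hps.trace_nonneg).2
      simpa using this.symm
    have hre : (A * Aᴴ).trace.re = 0 := by rw [hA.eq]; exact h
    have htr : (A * Aᴴ).trace = 0 := Complex.ext (by simpa using hre) (by simpa using him)
    exact Matrix.trace_mul_conjTranspose_self_eq_zero_iff.mp htr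
  · rintro rfl; simp

omit [DecidableEq m] [DecidableEq n] in
/-- Symmetry of the pairing: `Re Tr(AB) = Re Tr(BA)`. [folklore] -/
private theorem re_trace_mul_comm (A B : Matrix (m × n) (m × n) ℂ) : (A * B).trace.re = (B * A).trace.re := by
  rw [trace_mul_comm]

/-! ## § 2 The witness operator of a guess `ρ̃` (§ 3.1) -/

/-- **§ 3.1, the displayed identity**: for a trace-one `ρ`, `Tr(ρ C') = ⟨ρ − ρ̃, ρ̃ − ρ_ent⟩` where
`C' = ρ̃ − ρ_ent − ⟨ρ̃, ρ̃ − ρ_ent⟩𝟙` («`⟨ρ, C⟩ = (1/‖ρ₁ − ρ₂‖)⟨ρ − ρ₁, ρ₁ − ρ₂⟩`», `ρ₁ = ρ̃`, `ρ₂ = ρ_ent`).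
[cite: BertlmannDurstbergerHiesmayrKrammer2005, §3.1 (the display before «Then the plane P is determined by»)] -/
theorem re_trace_mul_witnessOp (T E : Matrix (m × n) (m × n) ℂ) {ρ : Matrix (m × n) (m × n) ℂ} (hρ1 : ρ.trace = 1) :
    (ρ * (T - E - (((T * (T - E)).trace.re : ℝ) : ℂ) • (1 : Matrix (m × n) (m × n) ℂ))).trace.re =
      ((ρ - T) * (T - E)).trace.re := by
  rw [Matrix.mul_sub, Matrix.mul_smul, Matrix.mul_one, trace_sub, trace_smul, hρ1, Matrix.sub_mul, trace_sub,
    Complex.sub_re, Complex.sub_re, smul_eq_mul, mul_one, Complex.ofReal_re]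

omit [DecidableEq m] [DecidableEq n] in
/-- **The Hilbert–Schmidt distance expanded about the guess**: `‖ρ − ρ_ent‖² = ‖ρ − ρ̃‖² + 2⟨ρ − ρ̃, ρ̃ − ρ_ent⟩ +
‖ρ̃ − ρ_ent‖²`. [cite: BertlmannDurstbergerHiesmayrKrammer2005, §3.1 («a hyperplane `P` that includes `ρ₁` and is
orthogonal to `ρ₁ − ρ₂`»)] -/
theorem hsDist_sq_expand (ρ T E : Matrix (m × n) (m × n) ℂ) :
    ((ρ - E) * (ρ - E)).trace.re =
      ((ρ - T) * (ρ - T)).trace.re + 2 * ((ρ - T) * (T - E)).trace.re + ((T - E) * (T - E)).trace.re := by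
  have h : ρ - E = (ρ - T) + (T - E) := by abel
  rw [h, Matrix.add_mul, Matrix.mul_add, Matrix.mul_add, trace_add, trace_add, trace_add, Complex.add_re,
    Complex.add_re, Complex.add_re, re_trace_mul_comm (T - E) (ρ - T)]
  ring

/-- **«By construction `⟨ρ_ent, C̃⟩ = −‖ρ̃ − ρ_ent‖ < 0`»**: `Tr(ρ_ent C') = −‖ρ̃ − ρ_ent‖²` for trace-one `ρ_ent`.
[cite: BertlmannKrammer2009, §3 (before Lemma 2: «by construction of `C̃` we always have `⟨ρ^ent, C̃⟩ = −‖ρ̃ − ρ^ent‖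
< 0`»)] -/
theorem re_trace_ent_mul_witnessOp (T : Matrix (m × n) (m × n) ℂ) {E : Matrix (m × n) (m × n) ℂ} (hE1 : E.trace = 1) :
    (E * (T - E - (((T * (T - E)).trace.re : ℝ) : ℂ) • (1 : Matrix (m × n) (m × n) ℂ))).trace.re =
      -((T - E) * (T - E)).trace.re := by
  rw [re_trace_mul_witnessOp T E hE1]
  have h : E - T = -(T - E) := by abel
  rw [h, Matrix.neg_mul, trace_neg, Complex.neg_re]

/-! ## § 3 The Lemma -/

/-- **(⇐) A witness certifies the nearest separable state**: if `Tr(ρC') ≥ 0` for every separable `ρ` (the first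
witness inequality), then `ρ̃` minimises the Hilbert–Schmidt distance to `ρ_ent` over the separable states.
[cite: BertlmannDurstbergerHiesmayrKrammer2005, §3.3 Lemma (⇐)] [cite: BertlmannFriis2023, §17.1.3 Lemma 17.1] -/
theorem isNearest_of_witnessOp_nonneg {T E : Matrix (m × n) (m × n) ℂ} (hT : T.IsHermitian)
    (hW : ∀ ρ : Matrix (m × n) (m × n) ℂ, IsSeparable ρ →
      0 ≤ ((T - E - (((T * (T - E)).trace.re : ℝ) : ℂ) • (1 : Matrix (m × n) (m × n) ℂ)) * ρ).trace.re) :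
    ∀ ρ : Matrix (m × n) (m × n) ℂ, IsSeparable ρ →
      ((T - E) * (T - E)).trace.re ≤ ((ρ - E) * (ρ - E)).trace.re := by
  intro ρ hρ
  have h := hW ρ hρ
  rw [← re_trace_mul_comm, re_trace_mul_witnessOp T E hρ.trace_eq_one] at h
  have hpos := re_trace_mul_self_nonneg (A := ρ - T) (hρ.posSemidef.1.sub hT)
  rw [hsDist_sq_expand ρ T E]
  linarith

/-- **(⇒) The nearest separable state yields a witness** («the plane has to be tangent to the set `S`»): if the
separable `ρ̃` minimises the Hilbert–Schmidt distance to `ρ_ent` over `S`, then `Tr(ρC') ≥ 0` for every separable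
`ρ` — there are no «left-hand separable states». Proof by the segment `tρ + (1−t)ρ̃ ⊆ S`.
[cite: BertlmannDurstbergerHiesmayrKrammer2005, §3.2–§3.3 Lemma (⇒)] [cite: BertlmannFriis2023, §17.1.3 Lemma 17.1] -/
theorem witnessOp_nonneg_of_isNearest {T E : Matrix (m × n) (m × n) ℂ} (hT : IsSeparable T)
    (hmin : ∀ ρ : Matrix (m × n) (m × n) ℂ, IsSeparable ρ →
      ((T - E) * (T - E)).trace.re ≤ ((ρ - E) * (ρ - E)).trace.re) :
    ∀ ρ : Matrix (m × n) (m × n) ℂ, IsSeparable ρ →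
      0 ≤ ((T - E - (((T * (T - E)).trace.re : ℝ) : ℂ) • (1 : Matrix (m × n) (m × n) ℂ)) * ρ).trace.re := by
  intro ρ hρ
  rw [← re_trace_mul_comm, re_trace_mul_witnessOp T E hρ.trace_eq_one]
  -- the segment `ρ_t = t ρ + (1 − t) T`, `t ∈ [0,1]`, stays separable
  set s : ℝ := ((ρ - T) * (T - E)).trace.re with hs
  set K : ℝ := ((ρ - T) * (ρ - T)).trace.re with hK
  have hK0 : 0 ≤ K := re_trace_mul_self_nonneg (hρ.posSemidef.1.sub hT.posSemidef.1)
  have hseg : ∀ t : ℝ, 0 ≤ t → t ≤ 1 → 0 ≤ 2 * t * s + t ^ 2 * K := by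
    intro t ht0 ht1
    have hmix := hT.mix hρ (sub_nonneg.mpr ht1) (sub_le_self 1 ht0)
    -- `(1 - t) T + (1 - (1 - t)) ρ = T + t (ρ − T)`
    have hρt : (((1 - t : ℝ) : ℂ) • T + ((1 - (1 - t) : ℝ) : ℂ) • ρ) - E = (T - E) + (t : ℂ) • (ρ - T) := by
      rw [sub_sub_cancel, smul_sub]
      have : ((1 - t : ℝ) : ℂ) = 1 - (t : ℂ) := by push_cast; ring
      rw [this, sub_smul, one_smul]
      abel
    have h := hmin _ hmix
    rw [hρt] at h
    simp only [Matrix.add_mul, Matrix.mul_add, Matrix.smul_mul, Matrix.mul_smul, trace_add, trace_smul, smul_eq_mul,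
      Complex.add_re, Complex.re_ofReal_mul] at h
    rw [re_trace_mul_comm (T - E) (ρ - T), ← hs, ← hK] at h
    nlinarith [h]
  -- if `s < 0`, a small `t` violates the segment inequality
  by_contra hneg
  push Not at hneg
  set t : ℝ := min 1 (-s / (K + 1)) with ht
  have hK1 : 0 < K + 1 := by linarith
  have ht0 : 0 < t := lt_min one_pos (div_pos (by linarith) hK1)
  have ht1 : t ≤ 1 := min_le_left _ _
  have htK : t * (K + 1) ≤ -s := by
    have : t ≤ -s / (K + 1) := min_le_right _ _
    rwa [le_div_iff₀ hK1] at this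
  have h := hseg t ht0.le ht1
  -- `2ts + t²K ≤ 2ts + t·(tK + t) ≤ 2ts − ts = ts < 0`
  have h1 : t ^ 2 * K ≤ t * (-s) := by nlinarith
  nlinarith

/-- **Lemma (Bertlmann–Durstberger–Hiesmayr–Krammer 2005, § 3.3; Bertlmann–Krammer 2009 Lemma 1; Bertlmann–Friis
Lemma 17.1)**: for an entangled state `ρ_ent` and a separable guess `ρ̃`, `ρ̃` is a nearest separable state to `ρ_ent`
(in Hilbert–Schmidt distance) if and only if `C' = ρ̃ − ρ_ent − ⟨ρ̃, ρ̃ − ρ_ent⟩𝟙` — a positive multiple of the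
printed `C̃ = C'/‖ρ̃ − ρ_ent‖` — is an entanglement witness (the tree's `IsWitness`: non-negative on all separable
states, negative on some entangled state; here `Tr(ρ_ent C') = −‖ρ̃ − ρ_ent‖² < 0`).
[cite: BertlmannDurstbergerHiesmayrKrammer2005, §3.3 Lemma] [cite: BertlmannKrammer2009, §3 Lemma 1]
[cite: BertlmannFriis2023, §17.1.3 Lemma 17.1] -/
theorem isNearest_iff_isWitness {T E : Matrix (m × n) (m × n) ℂ} (hT : IsSeparable T) (hE : E.PosSemidef)
    (hE1 : E.trace = 1) (hEent : ¬ IsSeparable E) :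
    (∀ ρ : Matrix (m × n) (m × n) ℂ, IsSeparable ρ →
        ((T - E) * (T - E)).trace.re ≤ ((ρ - E) * (ρ - E)).trace.re) ↔
      IsWitness (T - E - (((T * (T - E)).trace.re : ℝ) : ℂ) • (1 : Matrix (m × n) (m × n) ℂ)) := by
  constructor
  · intro hmin
    refine ⟨witnessOp_nonneg_of_isNearest hT hmin, E, hE, hE1, hEent, ?_⟩
    rw [← re_trace_mul_comm, re_trace_ent_mul_witnessOp T hE1]
    -- `‖T − E‖² > 0` since `T ≠ E` (`T` is separable, `E` is not)
    have hne : T - E ≠ 0 := fun h => hEent (by rw [sub_eq_zero] at h; exact h ▸ hT)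
    have hpos : 0 < ((T - E) * (T - E)).trace.re :=
      lt_of_le_of_ne (re_trace_mul_self_nonneg (hT.posSemidef.1.sub hE.1))
        (fun h => hne ((re_trace_mul_self_eq_zero_iff (hT.posSemidef.1.sub hE.1)).mp h.symm))
    linarith
  · intro hW
    exact isNearest_of_witnessOp_nonneg hT.posSemidef.1 hW.1

end Literature.InformationTheory.Entanglement.NearestSeparable
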